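import Summits.QuantumFields.BalabanUV.Beta.FP.PerfectPropagatorReflection
import Literature.MathematicalPhysics.QuantumFieldTheory.Balaban1983to89.Beta.ResolventReflection

/-!
# `BalabanUV.Beta.FP.PerfectPropagatorReflectionCell` — road «FP» for binder row D1, sub-row **H2-ASM-5a** (Kcov), module R2 layer c (the located note
# N-d1leaf02g9-1 made kernel-precise): the junction of the gluon leg `Pker` of H2V-0 with THE CELL'S reflection leg map `ResolventReflection.Φ N α`
# (the one under which `KInv`, `KInvStep` are invariant and the Wilson ∕ rooted jets are covariant): the SITE-SWAPPED leg `(x, z) ↦ Pker z x` — on the field block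
# `Re PinfKer β γ (x − z)`, the cell's kernel convention `Re K[·](x − y)` of `CombesThomasFibre.KInv_eq_re_latticeKernel` — IS `Φ N α`-invariant for every `N`,
# while `Pker` itself is invariant under the MIRRORED field-leg relabelling of layer b (`PerfectPropagatorReflection.refK_Pker_eq_of_legMap`)

HONEST DEPENDENCY (page 1, mandatory): continuum YM on T⁴ ⇐ BetaPertH ∧ nine spine estimates (0/9 proved); BetaPertH ⇐ (D1) ∧ (D4) ∧ CAP+tail;
G-an2-4 gates asym, D1 and NE2/3/4.  HONEST FRAMING (cell contract, verbatim): «discharging `BetaPertH` makes Bałaban's UV stability UNCONDITIONAL —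
a real constructive-QFT result; it is NOT the continuum limit and NOT the Clay problem.»  THIS MODULE DISCHARGES NOTHING of the wall: [folklore] re-indexing over
layer b's reflection law `PinfKer_axisReflect` and an2∕an5's `ResolventReflection.Φ`∕`bref` BY NAME; 0 def, 0 `def … : Prop`, nothing cited, 0 sorry; 0∕4 row-D1 binders;
it ASSERTS NO DEFECT — it records, as two kernel theorems, WHICH leg relabelling leaves WHICH index attachment of the explicit perfect propagator invariant, so that the
owner of H2V-0 and the suppliers of the vertex-side (a7) letters of `PerfectPolarizationReflection.axisReflectionCovariant_flip_PiBF` can choose consistently;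
NOT hgerm, NOT D1, NOT BetaPertH, NOT continuum, NOT Clay.

ABSOLUTE RULE (cell charter, verbatim): «No internally-minted statement may enter as a cited fact. Every hypothesis is either kernel-proved in this package or a
verbatim quotation of a PUBLISHED theorem with page reference. The manuscript(s) under audit are NOT citable for their own disputed steps — they are the thing
under adjudication; programme-internal (2001/route/tribunal) claims are never citable.»

CONTENT ([folklore]∕[our object]): `Pker_swap_inl_inl` (the site-swapped field block is `Re PinfKer β γ (x − z)`); `bref_sub_bref` (`bref α β x − bref α γ z = ε(x − z) − [β=α]e_α + [γ=α]e_α`);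
**`refK_cellLegMap_Pker_swap`**: `refK (ResolventReflection.Φ N α) (fun x z a b => Pker z x a b) = fun x z a b => Pker z x a b` for EVERY `N` and every axis `α` (the
multiplier legs `mref N α κ` act on vanishing blocks).  READING (asserted nowhere as a defect): `ExpKernelCalculus.comp`∕`bubble`∕`tadpole` read an `MKer` entry `K x z a b`
as «leg `a` at `x`, leg `b` at `z`»; with that reading the cell's jets are reflection-covariant under `Φ N α` (`ResolventReflection.vertexOfK_reflect`, (Sr)∕(Wr)), and the
gluon leg matching them under the SAME `Φ` is the site-swapped one; `Pker` as defined in H2V-0 (`Re PinfKer α β (z − x)`) matches vertex data covariant under the mirrored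
map instead.  Which attachment the road's `PiBF` wants is decided at H2V-0 ∕ H2V-4, not here.
Provenance: D1 formalisation swarm seat b2b-balaban-beta-d1-formalise-leaf-02 gen 9 (road FP engine lineage; sub-row H2-ASM-5a (Kcov) REFLECTION HALF), 2026-08-21.
-/

noncomputable section

namespace Summit.QuantumFields.BalabanUV.Beta.FP.PerfectPropagatorReflectionCell

open Literature.MathematicalPhysics.QuantumFieldTheory.Balaban1983to89
open Literature.MathematicalPhysics.QuantumFieldTheory.Balaban1983to89.Beta
open B6BondElimination (unitVec unitVec_apply)
open PolarizationSign (axisReflect axisReflect_apply reflSign)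
open ExpKernelCalculus (MKer Site)
open OneStepResolventKernel (Fib)
open KernelReflection (LegMap refK refK_apply)
open ResolventReflection (bref bref_apply Φ_r_inl Φ_s_inl)
open Summit.QuantumFields.BalabanUV.Beta.FP.PerfectPropagatorKernel (PinfKer)
open Summit.QuantumFields.BalabanUV.Beta.FP.PerfectPolarization (Pker Pker_inl_inl Pker_inl_inr Pker_inr_inl Pker_inr_inr)
open Summit.QuantumFields.BalabanUV.Beta.FP.PerfectPropagatorReflection (PinfKer_axisReflect)

/-- [our object] the field block of the SITE-SWAPPED gluon leg is the perfect propagator kernel in the cell's difference variable (first leg) − (second leg):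
`Pker z x (inl β) (inl γ) = Re PinfKer β γ (x − z)`. -/
theorem Pker_swap_inl_inl (x z : Site 4) (β γ : Fin 4) : Pker z x (Sum.inl β) (Sum.inl γ) = (PinfKer (d := 3) β γ (x - z)).re := rfl

/-- [folklore] the difference of two reflected bond base points of the cell's leg map:
`bref α β x − bref α γ z = ε(x − z) − [β=α]e_α + [γ=α]e_α` (the block-compatible offsets `−1` cancel). -/
theorem bref_sub_bref {D : ℕ} (α β γ : Fin D) (x z : Fin D → ℤ) :
    bref α β x - bref α γ z = axisReflect α (x - z) - (if β = α then unitVec α else 0) + (if γ = α then unitVec α else 0) := by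
  funext i
  simp only [Pi.sub_apply, Pi.add_apply, bref_apply, axisReflect_apply]
  by_cases hi : i = α <;> by_cases hβ : β = α <;> by_cases hγ : γ = α <;> simp [hi, hβ, hγ, unitVec_apply] <;> ring

/-- [our object] **THE SITE-SWAPPED GLUON LEG IS INVARIANT UNDER THE CELL'S REFLECTION LEG MAP**: for every blocking `N` and every axis `α`,
`refK (ResolventReflection.Φ N α) (fun x z a b => Pker z x a b) = fun x z a b => Pker z x a b` (field legs moved by `bref α κ`, signs `reflSign α κ`; the multiplier
legs, moved by `mref N α κ`, touch only vanishing blocks) — by layer b's reflection law `PinfKer_axisReflect` read in the variable `x − z`. -/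
theorem refK_cellLegMap_Pker_swap (N : ℕ) (α : Fin 4) :
    refK (ResolventReflection.Φ (d := 3) N α) (fun x z a b => Pker z x a b) = fun x z a b => Pker z x a b := by
  funext x z a b
  rcases a with β | β <;> rcases b with γ | γ
  · rw [refK_apply, Φ_s_inl, Φ_s_inl, Φ_r_inl, Φ_r_inl, Pker_swap_inl_inl, Pker_swap_inl_inl, bref_sub_bref, PinfKer_axisReflect,
      Complex.re_ofReal_mul]
    have h1 : ∀ κ : Fin 4, reflSign α κ * reflSign α κ = 1 := fun κ => by unfold reflSign; split_ifs <;> norm_num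
    calc reflSign α β * reflSign α γ * (reflSign α β * reflSign α γ * (PinfKer (d := 3) β γ (x - z)).re)
        = (reflSign α β * reflSign α β) * (reflSign α γ * reflSign α γ) * (PinfKer (d := 3) β γ (x - z)).re := by ring
      _ = (PinfKer (d := 3) β γ (x - z)).re := by rw [h1, h1, one_mul, one_mul]
  · rw [refK_apply, Pker_inl_inr, Pker_inl_inr, mul_zero]
  · rw [refK_apply, Pker_inr_inl, Pker_inr_inl, mul_zero]
  · rw [refK_apply, Pker_inr_inr, Pker_inr_inr, mul_zero]

/-- [our object] the same fact for the cell's BOND map read with `KernelReflection.bondRefl α 1` (`ResolventReflection.bref_eq_bondRefl`): the site-swapped field block is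
covariant in the printed shape, `Pker (bref α γ z) (bref α β x) (inl β) (inl γ) = ε_β ε_γ · Pker z x (inl β) (inl γ)`. -/
theorem Pker_swap_bref (α β γ : Fin 4) (x z : Site 4) :
    Pker (bref α γ z) (bref α β x) (Sum.inl β) (Sum.inl γ) = reflSign α β * reflSign α γ * Pker z x (Sum.inl β) (Sum.inl γ) := by
  rw [Pker_swap_inl_inl, Pker_swap_inl_inl, bref_sub_bref, PinfKer_axisReflect, Complex.re_ofReal_mul]

end Summit.QuantumFields.BalabanUV.Beta.FP.PerfectPropagatorReflectionCell

end
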